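import Summits.BirchSwinnertonDyer.Rank1Residual.X5.TwoAdicTargetsMC
import Summits.BirchSwinnertonDyer.Rank1Residual.X5.TwoAdicTargetsEisenstein
import HarnessLib

/-!
# Route ByReductionTypeAtTwo / TwoAdicConverse — the good-ordinary-at-`2` HALF statements as CLOSED
# `Prop` leaves in a standalone Theorems module (importable by route files; no route file imported)

Why this file exists (seat bsd-2adic-ord GEN 5, 2026-08-26): the layer-2 split of the crux
`GoodOrdinaryRankZeroAtTwo` types its children with the Summits-side objects
`X5.O1.MainConjectureLowerDivisibilityAtTwoOrd` / `X5.O1.MainConjectureEisensteinDivisibilityAtTwo`, which live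
in `Summits.BirchSwinnertonDyer.Rank1Residual.X5.*` — modules a ROUTE file could not import when the split
first ran. A route file MAY import `Summits.BirchSwinnertonDyer.BirchSwinnertonDyer.Theorems.*`; so the two crux
statements are restated here VERBATIM as closed `Prop`s (nothing asserted, no new object: each is a
`def … : Prop` whose body is the children-S1/S2 statement of plan/routes/split-g10, fully qualified), and
the two CRUX children may be typed as these `@[conjecture]` constants; the two SUPPORT conjunctions of
published inputs were relocated by the gate to `Literature.Uncategorized.OrdPublishedInputsAtTwo` /
`Literature.Uncategorized.OrdConversePublishedInputsAtTwo` (p414669, importable by route files as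
`Literature.*`). `Iff.rfl` lemmas record that nothing was changed. This module imports NO Theses file
(no glue.cyclic-import).
-/

set_option autoImplicit false

namespace Summit.BirchSwinnertonDyer.BirchSwinnertonDyer.Theorems.OrdHalvesAtTwo

/-- [crux] The KATO–NÉRON half of the 2-adic cyclotomic main conjecture on the class «non-CM, analytic rank
0, good ordinary at 2»: `X5.O1.MainConjectureLowerDivisibilityAtTwoOrd W` for every such `W`
(= children-S1 `OrdKatoHalfAtTwo`, verbatim). Not in print at `p = 2` (Kato 17.4 (3) prints `p ≠ 2`);
equivalent modulo print to the μ-part `X5.O1.KatoMuPartAtTwo`. Nothing asserted.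
[cite: Kato2004Asterisque, Thm. 17.4 (p. 273) (shape; p = 2 integral clause NOT in print)] -/
@[conjecture] def OrdKatoHalfAtTwo : Prop :=
  ∀ (W : WeierstrassCurve ℚ) [W.IsElliptic] [W.IsGloballyMinimal], ¬ W.HasCM → W.analyticRank = 0 →
    Literature.NumberTheory.EllipticCurves.Rank1Residual.GoodOrd W 2 →
    Summit.BirchSwinnertonDyer.Rank1Residual.X5.O1.MainConjectureLowerDivisibilityAtTwoOrd W

/-- [crux] The EISENSTEIN (Skinner–Urban) half of the 2-adic cyclotomic main conjecture, Néron
normalisation, for every non-CM curve good ordinary at 2 (rank-free; shared by both routes)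
(= children-S1/S2 `OrdEisensteinHalfAtTwo`, verbatim). Nothing in print at `p = 2`. Nothing asserted.
[cite: SkinnerUrban2014, Thm. 3.6.9 / §3.6 (p odd; shape only; nothing asserted)] -/
@[conjecture] def OrdEisensteinHalfAtTwo : Prop :=
  ∀ (W : WeierstrassCurve ℚ) [W.IsElliptic] [W.IsGloballyMinimal], ¬ W.HasCM →
    Literature.NumberTheory.EllipticCurves.Rank1Residual.GoodOrd W 2 →
    Summit.BirchSwinnertonDyer.Rank1Residual.X5.O1.MainConjectureEisensteinDivisibilityAtTwo W

/-- Bookkeeping: the Kato half unfolds to its children-S1 text. [folklore] -/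
theorem ordKatoHalfAtTwo_iff : OrdKatoHalfAtTwo ↔
    ∀ (W : WeierstrassCurve ℚ) [W.IsElliptic] [W.IsGloballyMinimal], ¬ W.HasCM → W.analyticRank = 0 →
      Literature.NumberTheory.EllipticCurves.Rank1Residual.GoodOrd W 2 →
      Summit.BirchSwinnertonDyer.Rank1Residual.X5.O1.MainConjectureLowerDivisibilityAtTwoOrd W :=
  Iff.rfl

/-- Bookkeeping: the Eisenstein half unfolds to its children-S1/S2 text. [folklore] -/
theorem ordEisensteinHalfAtTwo_iff : OrdEisensteinHalfAtTwo ↔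
    ∀ (W : WeierstrassCurve ℚ) [W.IsElliptic] [W.IsGloballyMinimal], ¬ W.HasCM →
      Literature.NumberTheory.EllipticCurves.Rank1Residual.GoodOrd W 2 →
      Summit.BirchSwinnertonDyer.Rank1Residual.X5.O1.MainConjectureEisensteinDivisibilityAtTwo W :=
  Iff.rfl

end Summit.BirchSwinnertonDyer.BirchSwinnertonDyer.Theorems.OrdHalvesAtTwo
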